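import Mathlib.Algebra.MvPolynomial.NoZeroDivisors
import Literature.Computability.Complexity.HermitianSosRefutation
import Literature.Computability.Complexity.SumOfSquaresRefutation
import Literature.RingTheory.Nullstellensatz.PerronTheorem
import HarnessLib

/-!
# Hermitian versus real coordinates for complex polynomial identities

Definition request `defn-HasHermitianSosRefutationOfDegree` (route ValiantsHypothesis/
RefutationDegree), infrastructure for its optional item (3) — the identification of Hermitian
sums-of-squares refutations (`HasHermitianSosRefutationOfDegree`, `HermitianSosRefutation.lean`,
polynomial identities in `ℂ[σ ⊕ σ]` = a holomorphic and an anti-holomorphic copy of each variable,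
with the Hermitian conjugation `cj = hermConj`) with real Positivstellensatz refutations of the
realified system (`HasSOSRefutation (realifySystem g)`, `SumOfSquaresRefutation.lean`, identities
in `ℝ[σ × Bool]` = real and imaginary coordinates). The equivalence itself is
`HermitianSosRealification.lean`; here is the change of coordinates.

## Contents (definitions real, lemmas proved)

* `toRealCoords : ℂ[σ ⊕ σ] →ₐ[ℂ] ℂ[σ × Bool]`, `z_s ↦ u_s + i v_s`, `z̄_s ↦ u_s - i v_s`
  (`u_s = X (s,false)`, `v_s = X (s,true)`, the coordinates of `realifyVars`), and its inverse
  `ofRealCoords` (`u_s ↦ (z_s + z̄_s)/2`, `v_s ↦ -i (z_s - z̄_s)/2`); `Ψ ∘ Φ = id`, `Φ ∘ Ψ = id`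
  (checked on generators), packaged as `realCoordsAlgEquiv : ℂ[σ ⊕ σ] ≃ₐ[ℂ] ℂ[σ × Bool]`.
* `toRealCoords_hermConj`: `Φ (cj p) = conj (Φ p)` — Hermitian conjugation is conjugation of the
  coefficients in real coordinates (so the `cj`-fixed elements are exactly the real polynomials
  in `u, v`); `toRealCoords_rename_inl`: `Φ (rename inl g) = realifyVars g`;
  `eval_realCoords_toRealCoords`: `p (z, z̄) = (Φ p)(Re z, Im z)` (ties `conjPoint` to `realCoords`).
* Degrees: both maps substitute linear forms, so `deg Φ p = deg p` (`totalDegree_toRealCoords`);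
  `deg cj p = deg p`; a Hermitian square `q cj q` of degree `≤ 2d` has `deg q ≤ d`
  (`totalDegree_le_of_mul_hermConj_le`, `ℂ[σ ⊕ σ]` being a domain); and
  `totalDegree_part_mul_part_le`, the degree bookkeeping for products of real/imaginary parts.

Standard Hermitian bookkeeping (e.g. J. P. D'Angelo, *Hermitian analysis*, Ch. 2: a real-valued
polynomial in `z, z̄` is a Hermitian symmetric polynomial); no named facts.

## References

* J. Krajíček, *Proof Complexity*, CUP 2019, §6.4 (SOS proofs, degree). [KrajicekProofComplexity2019]
* D. Grigoriev, *Complexity of Positivstellensatz proofs for the knapsack*, Comput. Complexity 10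
  (2001) 139–154, Def. 0.5. [Grigoriev2001]
-/

noncomputable section

open MvPolynomial Finset
open scoped ComplexConjugate

namespace Literature.Computability.Complexity

variable {ι σ : Type*}

/-! ### Small degree facts -/

/-- `deg (c · p) ≤ deg p`. [folklore] -/
theorem totalDegree_C_mul_le {R υ : Type*} [CommSemiring R] (c : R) (p : MvPolynomial υ R) :
    (C c * p).totalDegree ≤ p.totalDegree := by
  rw [C_mul']
  exact totalDegree_smul_le _ _

/-- `½ · 2 = 1` for constant polynomials over `ℂ`. [folklore] -/
theorem C_half_mul_two {υ : Type*} : (C (1 / 2 : ℂ) : MvPolynomial υ ℂ) * 2 = 1 := by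
  rw [← map_ofNat C 2, ← C_mul, ← C_1]
  congr 1
  norm_num

/-- `i · (-i/2) = ½` for constant polynomials. [folklore] -/
theorem C_I_mul_C_neg_I_half {υ : Type*} :
    (C Complex.I : MvPolynomial υ ℂ) * C (-Complex.I / 2) = C (1 / 2 : ℂ) := by
  rw [← C_mul]
  congr 1
  rw [mul_div_assoc', mul_neg, Complex.I_mul_I, neg_neg]

/-- Hermitian conjugation does not raise the degree. [folklore] -/
theorem totalDegree_hermConj_le (p : MvPolynomial (σ ⊕ σ) ℂ) :
    (hermConj p).totalDegree ≤ p.totalDegree := by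
  rw [hermConj_apply]
  refine (totalDegree_rename_le _ _).trans ?_
  rw [totalDegree, totalDegree]
  exact Finset.sup_mono (support_map_subset _ _)

/-- Hermitian conjugation preserves the degree. [folklore] -/
theorem totalDegree_hermConj (p : MvPolynomial (σ ⊕ σ) ℂ) :
    (hermConj p).totalDegree = p.totalDegree :=
  le_antisymm (totalDegree_hermConj_le p)
    (by simpa only [hermConj_hermConj] using totalDegree_hermConj_le (hermConj p))

/-- A Hermitian square `q · cj q` of degree `≤ 2d` has `deg q ≤ d` (`ℂ[σ ⊕ σ]` is a domain).
[folklore] -/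
theorem totalDegree_le_of_mul_hermConj_le {q : MvPolynomial (σ ⊕ σ) ℂ} {d : ℕ}
    (h : (q * hermConj q).totalDegree ≤ 2 * d) : q.totalDegree ≤ d := by
  by_cases hq : q = 0
  · rw [hq, totalDegree_zero]; exact Nat.zero_le _
  have hcq : hermConj q ≠ 0 := fun h0 => hq (by rw [← hermConj_hermConj q, h0, map_zero])
  rw [totalDegree_mul_of_isDomain hq hcq, totalDegree_hermConj] at h
  omega

/-! ### Hermitian versus real coordinates -/

section Coordinates

/-- **Hermitian → real coordinates** `Φ : ℂ[σ ⊕ σ] →ₐ ℂ[σ × Bool]`: `z_s = X (inl s) ↦ u_s + i v_s`,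
`z̄_s = X (inr s) ↦ u_s - i v_s` (`u_s = X (s, false)`, `v_s = X (s, true)`, the real coordinates of
`SumOfSquaresRefutation.realifyVars`). [folklore] -/
def toRealCoords : MvPolynomial (σ ⊕ σ) ℂ →ₐ[ℂ] MvPolynomial (σ × Bool) ℂ :=
  aeval (Sum.elim (fun s : σ => (X (s, false) + C Complex.I * X (s, true) : MvPolynomial (σ × Bool) ℂ))
    (fun s : σ => X (s, false) - C Complex.I * X (s, true)))

/-- **Real → Hermitian coordinates** `Ψ : ℂ[σ × Bool] →ₐ ℂ[σ ⊕ σ]`: `u_s ↦ (z_s + z̄_s)/2`,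
`v_s ↦ -i (z_s - z̄_s)/2`. [folklore] -/
def ofRealCoords : MvPolynomial (σ × Bool) ℂ →ₐ[ℂ] MvPolynomial (σ ⊕ σ) ℂ :=
  aeval fun p : σ × Bool =>
    if p.2 then C (-Complex.I / 2) * (X (Sum.inl p.1) - X (Sum.inr p.1))
    else C (1 / 2 : ℂ) * (X (Sum.inl p.1) + X (Sum.inr p.1) : MvPolynomial (σ ⊕ σ) ℂ)

/-- `Φ z_s = u_s + i v_s`. [folklore] -/
@[simp] theorem toRealCoords_X_inl (s : σ) :
    toRealCoords (X (Sum.inl s) : MvPolynomial (σ ⊕ σ) ℂ) = X (s, false) + C Complex.I * X (s, true) := by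
  rw [toRealCoords, aeval_X, Sum.elim_inl]

/-- `Φ z̄_s = u_s - i v_s`. [folklore] -/
@[simp] theorem toRealCoords_X_inr (s : σ) :
    toRealCoords (X (Sum.inr s) : MvPolynomial (σ ⊕ σ) ℂ) = X (s, false) - C Complex.I * X (s, true) := by
  rw [toRealCoords, aeval_X, Sum.elim_inr]

/-- `Ψ u_s = (z_s + z̄_s)/2`. [folklore] -/
@[simp] theorem ofRealCoords_X_false (s : σ) :
    ofRealCoords (X (s, false) : MvPolynomial (σ × Bool) ℂ) =
      C (1 / 2 : ℂ) * (X (Sum.inl s) + X (Sum.inr s)) := by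
  rw [ofRealCoords, aeval_X]
  rfl

/-- `Ψ v_s = -i (z_s - z̄_s)/2`. [folklore] -/
@[simp] theorem ofRealCoords_X_true (s : σ) :
    ofRealCoords (X (s, true) : MvPolynomial (σ × Bool) ℂ) =
      C (-Complex.I / 2) * (X (Sum.inl s) - X (Sum.inr s)) := by
  rw [ofRealCoords, aeval_X]
  rfl

/-- `Φ` fixes constants. [folklore] -/
@[simp] theorem toRealCoords_C (c : ℂ) : toRealCoords (C c : MvPolynomial (σ ⊕ σ) ℂ) = C c := by
  rw [algHom_C, algebraMap_eq]

/-- `Ψ` fixes constants. [folklore] -/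
@[simp] theorem ofRealCoords_C (c : ℂ) : ofRealCoords (C c : MvPolynomial (σ × Bool) ℂ) = C c := by
  rw [algHom_C, algebraMap_eq]

/-- `Ψ ∘ Φ = id`. [folklore] -/
theorem ofRealCoords_comp_toRealCoords :
    (ofRealCoords (σ := σ)).comp toRealCoords = AlgHom.id ℂ (MvPolynomial (σ ⊕ σ) ℂ) := by
  refine algHom_ext fun v => ?_
  have h2 := C_half_mul_two (υ := σ ⊕ σ)
  have hI := C_I_mul_C_neg_I_half (υ := σ ⊕ σ)
  rcases v with s | s
  · rw [AlgHom.comp_apply, AlgHom.id_apply, toRealCoords_X_inl, map_add, map_mul, ofRealCoords_C,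
      ofRealCoords_X_false, ofRealCoords_X_true, ← mul_assoc, hI]
    linear_combination (X (Sum.inl s) : MvPolynomial (σ ⊕ σ) ℂ) * h2
  · rw [AlgHom.comp_apply, AlgHom.id_apply, toRealCoords_X_inr, map_sub, map_mul, ofRealCoords_C,
      ofRealCoords_X_false, ofRealCoords_X_true, ← mul_assoc, hI]
    linear_combination (X (Sum.inr s) : MvPolynomial (σ ⊕ σ) ℂ) * h2

/-- `Φ ∘ Ψ = id`. [folklore] -/
theorem toRealCoords_comp_ofRealCoords :
    (toRealCoords (σ := σ)).comp ofRealCoords = AlgHom.id ℂ (MvPolynomial (σ × Bool) ℂ) := by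
  refine algHom_ext fun v => ?_
  have h2 := C_half_mul_two (υ := σ × Bool)
  have hI := C_I_mul_C_neg_I_half (υ := σ × Bool)
  obtain ⟨s, _ | _⟩ := v
  · rw [AlgHom.comp_apply, AlgHom.id_apply, ofRealCoords_X_false, map_mul, toRealCoords_C, map_add,
      toRealCoords_X_inl, toRealCoords_X_inr]
    linear_combination (X (s, false) : MvPolynomial (σ × Bool) ℂ) * h2
  · rw [AlgHom.comp_apply, AlgHom.id_apply, ofRealCoords_X_true, map_mul, toRealCoords_C, map_sub,
      toRealCoords_X_inl, toRealCoords_X_inr]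
    linear_combination (2 * X (s, true) : MvPolynomial (σ × Bool) ℂ) * hI +
      (X (s, true) : MvPolynomial (σ × Bool) ℂ) * h2

/-- `Ψ (Φ p) = p`. [folklore] -/
@[simp] theorem ofRealCoords_toRealCoords (p : MvPolynomial (σ ⊕ σ) ℂ) :
    ofRealCoords (toRealCoords p) = p :=
  AlgHom.congr_fun ofRealCoords_comp_toRealCoords p

/-- `Φ (Ψ P) = P`. [folklore] -/
@[simp] theorem toRealCoords_ofRealCoords (P : MvPolynomial (σ × Bool) ℂ) :
    toRealCoords (ofRealCoords P) = P :=
  AlgHom.congr_fun toRealCoords_comp_ofRealCoords P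

/-- `Φ` is injective. [folklore] -/
theorem toRealCoords_injective : Function.Injective (toRealCoords (σ := σ)) :=
  Function.LeftInverse.injective ofRealCoords_toRealCoords

/-- The change between Hermitian and real coordinates as an algebra isomorphism
`ℂ[σ ⊕ σ] ≃ₐ[ℂ] ℂ[σ × Bool]`. [folklore] -/
def realCoordsAlgEquiv : MvPolynomial (σ ⊕ σ) ℂ ≃ₐ[ℂ] MvPolynomial (σ × Bool) ℂ :=
  AlgEquiv.ofAlgHom toRealCoords ofRealCoords toRealCoords_comp_ofRealCoords
    ofRealCoords_comp_toRealCoords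

/-- The isomorphism is `Φ`. [folklore] -/
@[simp] theorem realCoordsAlgEquiv_apply (p : MvPolynomial (σ ⊕ σ) ℂ) :
    realCoordsAlgEquiv p = toRealCoords p := rfl

/-- **Hermitian conjugation is coefficient conjugation in real coordinates**:
`Φ (cj p) = conj (Φ p)`. [folklore] -/
theorem toRealCoords_hermConj (p : MvPolynomial (σ ⊕ σ) ℂ) :
    toRealCoords (hermConj p) = map (starRingEnd ℂ) (toRealCoords p) := by
  suffices H : (toRealCoords (σ := σ)).toRingHom.comp hermConj =
      (map (starRingEnd ℂ)).comp (toRealCoords (σ := σ)).toRingHom from RingHom.congr_fun H p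
  refine ringHom_ext (fun c => ?_) (fun v => ?_)
  · show toRealCoords (hermConj (C c)) = map (starRingEnd ℂ) (toRealCoords (C c))
    rw [hermConj_C, toRealCoords_C, toRealCoords_C, map_C]
  · show toRealCoords (hermConj (X v)) = map (starRingEnd ℂ) (toRealCoords (X v))
    rw [hermConj_X]
    rcases v with s | s
    · rw [Sum.swap_inl, toRealCoords_X_inr, toRealCoords_X_inl, map_add, map_mul, map_X, map_X,
        map_C, Complex.conj_I, C_neg, neg_mul, sub_eq_add_neg]
    · rw [Sum.swap_inr, toRealCoords_X_inl, toRealCoords_X_inr, map_sub, map_mul, map_X, map_X,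
        map_C, Complex.conj_I, C_neg, neg_mul, sub_neg_eq_add]

/-- **The holomorphic lift becomes the realification**: `Φ (rename inl g) = realifyVars g`.
[folklore] -/
theorem toRealCoords_rename_inl (g : MvPolynomial σ ℂ) :
    toRealCoords (rename Sum.inl g) = realifyVars g := by
  rw [toRealCoords, aeval_rename]
  rfl

/-- **Evaluation compatibility**: the value of `p` at the conjugate point `(z, z̄)` is the value
of `Φ p` at the real coordinates `(Re z, Im z)`. [folklore] -/
theorem eval_realCoords_toRealCoords (z : σ → ℂ) (p : MvPolynomial (σ ⊕ σ) ℂ) :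
    eval (fun t => (realCoords z t : ℂ)) (toRealCoords p) = eval (conjPoint z) p := by
  change eval₂Hom (RingHom.id ℂ) _ (bind₁ _ p) = _
  rw [eval₂Hom_bind₁]
  change eval (fun t => eval (fun t => (realCoords z t : ℂ)) (Sum.elim _ _ t)) p = _
  congr 2
  funext t
  rcases t with s | s
  · simp only [Sum.elim_inl, map_add, map_mul, eval_X, eval_C, conjPoint_inl, realCoords,
      Bool.false_eq_true, if_false, if_true]
    apply Complex.ext <;> simp
  · simp only [Sum.elim_inr, map_sub, map_mul, eval_X, eval_C, conjPoint_inr, realCoords,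
      Bool.false_eq_true, if_false, if_true]
    apply Complex.ext <;> simp

/-- The linear forms `u_s ± i v_s` have degree `≤ 1`. [folklore] -/
private theorem totalDegree_linForm_le {τ : Type*} (a b : τ) (c : ℂ) :
    (X a + C c * X b : MvPolynomial τ ℂ).totalDegree ≤ 1 :=
  (totalDegree_add _ _).trans (max_le (totalDegree_X (R := ℂ) a).le
    ((totalDegree_mul _ _).trans (by rw [totalDegree_C, totalDegree_X, zero_add])))

/-- `Φ` does not raise degrees (substitution of linear forms). [folklore] -/
theorem totalDegree_toRealCoords_le (p : MvPolynomial (σ ⊕ σ) ℂ) :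
    (toRealCoords p).totalDegree ≤ p.totalDegree := by
  have h := Literature.RingTheory.Nullstellensatz.totalDegree_aeval_le
    (Sum.elim (fun s : σ => (X (s, false) + C Complex.I * X (s, true) : MvPolynomial (σ × Bool) ℂ))
      (fun s : σ => X (s, false) - C Complex.I * X (s, true))) (δ := 1) ?_ p
  · rw [mul_one] at h
    exact h
  · rintro (s | s)
    · exact totalDegree_linForm_le _ _ _
    · rw [Sum.elim_inr, sub_eq_add_neg, ← neg_mul, ← C_neg]
      exact totalDegree_linForm_le _ _ _

/-- `Ψ` does not raise degrees. [folklore] -/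
theorem totalDegree_ofRealCoords_le (P : MvPolynomial (σ × Bool) ℂ) :
    (ofRealCoords P).totalDegree ≤ P.totalDegree := by
  have hX : ∀ v : σ ⊕ σ, (X v : MvPolynomial (σ ⊕ σ) ℂ).totalDegree ≤ 1 := fun v =>
    (totalDegree_X (R := ℂ) v).le
  have h := Literature.RingTheory.Nullstellensatz.totalDegree_aeval_le
    (fun p : σ × Bool => if p.2 then C (-Complex.I / 2) * (X (Sum.inl p.1) - X (Sum.inr p.1))
      else C (1 / 2 : ℂ) * (X (Sum.inl p.1) + X (Sum.inr p.1) : MvPolynomial (σ ⊕ σ) ℂ))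
    (δ := 1) ?_ P
  · rw [mul_one] at h
    exact h
  · rintro ⟨s, _ | _⟩
    · exact (totalDegree_C_mul_le _ _).trans
        ((totalDegree_add _ _).trans (max_le (hX _) (hX _)))
    · exact (totalDegree_C_mul_le _ _).trans
        ((totalDegree_sub _ _).trans (max_le (hX _) (hX _)))

/-- `Φ` preserves the total degree exactly. [folklore] -/
theorem totalDegree_toRealCoords (p : MvPolynomial (σ ⊕ σ) ℂ) :
    (toRealCoords p).totalDegree = p.totalDegree :=
  le_antisymm (totalDegree_toRealCoords_le p)
    (by simpa only [ofRealCoords_toRealCoords] using totalDegree_ofRealCoords_le (toRealCoords p))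

/-- Degrees of products of real/imaginary parts in real coordinates are controlled by the degree
of the product in Hermitian coordinates (the domain property of `ℂ[σ ⊕ σ]`). [folklore] -/
theorem totalDegree_part_mul_part_le
    (π₁ π₂ : MvPolynomial (σ × Bool) ℂ → MvPolynomial (σ × Bool) ℝ)
    (h₁ : ∀ P, (π₁ P).totalDegree ≤ P.totalDegree) (h₁0 : π₁ 0 = 0)
    (h₂ : ∀ P, (π₂ P).totalDegree ≤ P.totalDegree) (h₂0 : π₂ 0 = 0)
    (P Q : MvPolynomial (σ ⊕ σ) ℂ) :
    (π₁ (toRealCoords P) * π₂ (toRealCoords Q)).totalDegree ≤ (P * Q).totalDegree := by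
  by_cases hP : P = 0
  · rw [hP, map_zero, h₁0, zero_mul, totalDegree_zero]; exact Nat.zero_le _
  by_cases hQ : Q = 0
  · rw [hQ, map_zero, h₂0, mul_zero, totalDegree_zero]; exact Nat.zero_le _
  rw [totalDegree_mul_of_isDomain hP hQ]
  calc (π₁ (toRealCoords P) * π₂ (toRealCoords Q)).totalDegree
      ≤ (π₁ (toRealCoords P)).totalDegree + (π₂ (toRealCoords Q)).totalDegree := totalDegree_mul _ _
    _ ≤ (toRealCoords P).totalDegree + (toRealCoords Q).totalDegree := Nat.add_le_add (h₁ _) (h₂ _)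
    _ = P.totalDegree + Q.totalDegree := by rw [totalDegree_toRealCoords, totalDegree_toRealCoords]

end Coordinates

end Literature.Computability.Complexity

end
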